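import Summits.QuantumFields.YangMills.Theorems.UnitScaleTiltFluctuationComparisonRegPrGlobalSlackLegOldTermsKernelFormAnalytic
import Summits.QuantumFields.YangMills.Theorems.UnitScaleTiltFluctuationComparisonRegPrGlobalSlackLegLocalAnalyticT3
import HarnessLib

/-!
# `UnitScaleTiltFluctuationComparisonRegPrGlobalSlackLegNaturalChartBirthAnalytic` — THE BIRTH-CHART HALF OF THE NATURAL CHART FAMILY'S ANALYTICITY ROW IS THE RECORD'S: at a retained
# domain the canonical birth chart `Ψ_X + Λ_X` is `ChartAnalyticityAsCited` FROM the rows G3D-01 (`chart`) and G3D-07 (`Λc.chart`), and its leg-rescaled version follows on the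
# shrunk ball from a LOCALITY display (crux `FluctuationComparisonRegPrIntL`, stmt-QuantumFields-20520, STUB 3⁗χ(v4); cell `pub/ym-inputs`, seat ym-inputs-p11 (g2); count-neutral
# helper, def-free, registry untouched)

WHY.  ✓p630833 `chartAnalyticOwnΦ_rescaleW_naturalChart(_rows)` splits the own-indexed analyticity row (R2′) of the leg-rescaled natural chart family `Φ♮[birthChartRows q, N]` into
(a) the background family's row — the BIRTH charts `birthChartRows q` — at the listed point sets that are not blocks, and (b) a leg-weighted kernel budget at the listed blocks.  Below the
top the listed non-block point sets are the retained domains' point sets `domSet X` (`X ∈ newDomsRows q K b triv`, lattice level `b + 1 ≤ K`), where `birthChartRows q K b (domSet X) =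
Ψ_X + Λ_X` (✓`birthChartRows_domSet`), and the rows record CARRIES the sup-norm analyticity of both summands: G3D-01 `(runRows.steps b hb).chart X : ChartAnalyticityAsCited (Ψ_X) ρ
(C25·g_b·e^{−κ·dj X})` and G3D-07 `(𝔄.Λc b).chart X : ChartAnalyticityAsCited (Λ_X) ρ (C63·e^{−κ·dj X})`.  So half (a), below the top, is the record's up to print's localisation
«𝒫(X, ·) depends on U restricted to X̃» (p.263 L4), for which ym-inputs-p11 g0's brick ✓p623174 `chartAnalyticityAsCited_rescale_of_local` trades sup-norm analyticity on `ball 0 ρ`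
for leg-weighted analyticity on the shrunk ball `ρ·e^{−κ′R}`:

* `chartAnalyticityAsCited_add` — sums of two analytic bounded charts (bookkeeping the binder's namespace lacks).
* ★ **`chartAnalyticityAsCited_birthChartRows_domSet`** — `ChartAnalyticityAsCited (birthChartRows q K b (domSet X)) 𝔠.ρ ((𝔠.C25 + 𝔠.C63)·e^{−κ·dj X})` for `b + 1 ≤ K`,
  `X ∈ newDomsRows q K b triv` — FROM THE RECORD, no hypothesis; `chartAnalyticityAsCited_birthChartRows_of_mem_loc` — the same read at a listed new-level point set `Y` with the
  canonical tree length (`canonTreeLenRows_domSet`).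
* ★ **`chartAnalyticityAsCited_rescaleW_birthChartRows_domSet_of_local`** — under the LOCALITY DISPLAY «`Ψ_X` and `Λ_X` read only the legs `c` with `dist K b (domSet X) c ≤ R`»
  the leg-rescaled birth chart `rescaleΦw dist κ′ (birthChartRows q) K b (domSet X)` is `ChartAnalyticityAsCited … (𝔠.ρ·e^{−κ′R}) ((C25 + C63)·e^{−κ·dj X})` (`κ′ ≥ 0`).
* ★★ **`chartAnalyticOwnΦ_rescaleW_naturalChart_rows_of_local`** (§3) — THE ROW ITSELF: `ChartAnalyticOwnΦ (dataOfCoreRows q (canonPolymerRows q)) (rescaleΦw dist κ′ Φ♮[birthChartRows q, N]) κ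
  (𝔠.ρ·e^{−κ′R}) C_A` (`κ ≤ 𝔠.κ`, `C25 + C63 ≤ C_A`) from exactly three letters: (ℓ) locality of the retained charts, (k) the (43) kernel budget at the listed blocks, (t) the dummy
  top clause — below the top every listed non-block point set is a retained domain's (case analysis on `canonLocRows`).
So for the natural objects the analyticity row of the v4 door (✓p631357 `k1aLegRowsDisplayChiAtLowV4_of_kernelRows`, in own-indexed form via ✓p630833's split) is down to: the locality
display at the retained domains (NOT a row of `StepAlphaV3CoreAC` today — located by g0), print's (43) kernel decay at the blocks, and the dummy top clause (`k > K`, `{univ}`, read by no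
socket row).

HONEST SCOPE.  Bookkeeping over two record rows and one landed brick; locality stays a HYPOTHESIS; nothing of [Balaban1985UV3] asserted beyond the cited tree rows; no summit / rung / gap
claim (YM₃ on T³ is ladder rung R3, not the Clay problem).  L-floor: none.

References: T. Bałaban, CMP 102 (1985) 255–275 [Balaban1985UV3] (p.263 L4, (25) p.262, (29)–(30) p.263, (33)–(34) p.264, (45) p.267, (61)–(63) pp.271–272).
-/

set_option autoImplicit false

noncomputable section

open scoped BigOperators
open Finset Metric
open Literature.MathematicalPhysics.QuantumFieldTheory.Balaban1983to89
open Literature.MathematicalPhysics.QuantumFieldTheory.Balaban1983to89.T3ContinuumYM3Torus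
open Literature.MathematicalPhysics.QuantumFieldTheory.Balaban1983to89.T3AlphaInputsAC (AlphaDataT3)
open Literature.MathematicalPhysics.QuantumFieldTheory.Balaban1983to89.TreeLengthTorus (tsys)
open Literature.MathematicalPhysics.QuantumFieldTheory.Balaban1985CMP102
open Literature.MathematicalPhysics.QuantumFieldTheory.Balaban1985CMP102.Setting
open Literature.MathematicalPhysics.QuantumFieldTheory.Balaban1985CMP102.Binders (ChartAnalyticityAsCited)
open Summit.QuantumFields.Balaban3D.Carriers
open Summit.QuantumFields.Balaban3D.Proofs.Primitives
open Summit.QuantumFields.Balaban3D.Proofs.GroupModelLieC (lieC)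
open Summit.QuantumFields.Balaban3D.Proofs.ScalesArithmetic (gk_pos gk_le_one)
open Summit.QuantumFields.YangMills.Theorems
open Summit.QuantumFields.YangMills.Theorems.GlobalSlackKernelMatching
open Summit.QuantumFields.YangMills.Theorems.GlobalSlackCanonicalPolymers

namespace Summit.QuantumFields.YangMills.Theorems.GlobalSlackKernelLeg

/-! ## §1 Sums of analytic bounded charts -/

section Add

variable {E : Type*} [NormedAddCommGroup E] [NormedSpace ℂ E]

/-- The sum of two charts holomorphic on `ball 0 ρ` and bounded by `M₁`, `M₂` on `closedBall 0 (ρ/2)` is holomorphic there and bounded by `M₁ + M₂`. [folklore] -/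
theorem chartAnalyticityAsCited_add {Ψ₁ Ψ₂ : E → ℂ} {ρ M₁ M₂ : ℝ} (h₁ : ChartAnalyticityAsCited Ψ₁ ρ M₁) (h₂ : ChartAnalyticityAsCited Ψ₂ ρ M₂) :
    ChartAnalyticityAsCited (fun x => Ψ₁ x + Ψ₂ x) ρ (M₁ + M₂) :=
  ⟨h₁.1, h₁.2.1.add h₂.2.1, fun z hz => (norm_add_le _ _).trans (add_le_add (h₁.2.2 z hz) (h₂.2.2 z hz))⟩

end Add

/-! ## §2 The canonical birth chart at a retained domain is analytic FROM THE RECORD -/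

section Birth

variable {F : T3Family} {𝔠 : AlphaConsts F.L (suGroupModel 2).N} {γ : ℝ} {hγ : 0 < γ} {hγ1 : γ ≤ (min 𝔠.gamma0 1) ^ 2}
  (q : ∀ K, AlphaInputsT3AC.PkgCoreRows F 𝔠 γ hγ hγ1 K)

/-- ★ **THE BIRTH CHART AT A RETAINED DOMAIN IS `ChartAnalyticityAsCited` FROM THE RECORD**: for `b + 1 ≤ K` and `X ∈ newDomsRows q K b triv`,
`ChartAnalyticityAsCited (birthChartRows q K b (domSet X)) 𝔠.ρ ((𝔠.C25 + 𝔠.C63)·e^{−κ·dj X})` — the rows G3D-01 `(runRows.steps b hb).chart X` (amplitude `C25·g_b·e^{−κ dj X}`, `g_b ≤ 1`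
given away) and G3D-07 `(𝔄.Λc b).chart X` (amplitude `C63·e^{−κ dj X}`) on `birthChartRows_domSet`'s `Ψ_X + Λ_X`. [cite: Balaban1985UV3, (25) p.262, (29)-(30) p.263, (61)-(63) pp.271-272] -/
theorem chartAnalyticityAsCited_birthChartRows_domSet (K b : ℕ) (hb : b + 1 ≤ K) (X : (tsys 3 (nblkOf (SK F 𝔠 γ hγ hγ1 K) 𝔠.lane.carrier b)).Dom)
    (hX : X ∈ newDomsRows q K b (Hist.triv (F.P K) (b + 1))) :
    ChartAnalyticityAsCited (birthChartRows q K b (domSet (F := F) 𝔠.lane.carrier.M₁ K b X)) 𝔠.ρ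
      ((𝔠.C25 + 𝔠.C63) * Real.exp (-(𝔠.κ * (tsys 3 (nblkOf (SK F 𝔠 γ hγ hγ1 K) 𝔠.lane.carrier b)).dj X))) := by
  set e : ℝ := Real.exp (-(𝔠.κ * (tsys 3 (nblkOf (SK F 𝔠 γ hγ hγ1 K) 𝔠.lane.carrier b)).dj X)) with he
  have he0 : 0 ≤ e := (Real.exp_pos _).le
  have hg0 : 0 < (SK F 𝔠 γ hγ hγ1 K).gk b := gk_pos _ b
  have hg1 : (SK F 𝔠 γ hγ hγ1 K).gk b ≤ 1 := gk_le_one _ (SK F 𝔠 γ hγ hγ1 K).gK_le_one b (by show b ≤ K; omega)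
  have hcΨ : ChartAnalyticityAsCited (E := PBond (F.P K) b → ↥(lieC (suGroupModel 2))) (((q K).𝔖 b).Ψ X) 𝔠.ρ
      (𝔠.C25 * (SK F 𝔠 γ hγ hγ1 K).gk b * e) := ((q K).runRows.steps b hb).chart X
  have hcΛ : ChartAnalyticityAsCited (E := PBond (F.P K) b → ↥(lieC (suGroupModel 2))) (((q K).𝔄.Λc b).Ψ X) 𝔠.ρ (𝔠.C63 * e) :=
    ((q K).𝔄.Λc b).chart X
  have hsum := chartAnalyticityAsCited_add hcΨ hcΛ
  rw [birthChartRows_domSet q K b hb X hX]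
  refine ⟨hsum.1, hsum.2.1, fun z hz => (hsum.2.2 z hz).trans ?_⟩
  have h1 : 𝔠.C25 * (SK F 𝔠 γ hγ hγ1 K).gk b * e ≤ 𝔠.C25 * e := by
    have := 𝔠.C25_nonneg
    calc 𝔠.C25 * (SK F 𝔠 γ hγ hγ1 K).gk b * e ≤ 𝔠.C25 * 1 * e := by gcongr
      _ = 𝔠.C25 * e := by ring
  calc 𝔠.C25 * (SK F 𝔠 γ hγ hγ1 K).gk b * e + 𝔠.C63 * e ≤ 𝔠.C25 * e + 𝔠.C63 * e := by linarith
    _ = (𝔠.C25 + 𝔠.C63) * e := by ring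

/-- **THE SAME AT A LISTED NEW-LEVEL POINT SET, IN THE CANONICAL TREE-LENGTH CURRENCY**: for `b + 1 ≤ K` and `Y` listed at lattice level `b + 1`, term level `b + 1` of the rows datum
`dataOfCoreRows q (canonPolymerRows q)` (the retained domains' point sets), `ChartAnalyticityAsCited (birthChartRows q K b Y) 𝔠.ρ ((C25 + C63)·e^{−κ·𝓛_K(b+1, Y)})`
(`canonTreeLenRows_domSet`). [cite: Balaban1985UV3, (24)-(25) p.262, (29)-(30) p.263, (43) p.266] -/
theorem chartAnalyticityAsCited_birthChartRows_of_mem_loc (K b : ℕ) (hb : b + 1 ≤ K) (Y : Set (Site (F.P K) 0))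
    (hY : Y ∈ (AlphaInputsT3AC.dataOfCoreRows q (canonPolymerRows q)).Loc K (b + 1)
      ((AlphaInputsT3AC.dataOfCoreRows q (canonPolymerRows q)).triv K (b + 1)) (b + 1)) :
    ChartAnalyticityAsCited (birthChartRows q K b Y) 𝔠.ρ
      ((𝔠.C25 + 𝔠.C63) * Real.exp (-(𝔠.κ * (AlphaInputsT3AC.dataOfCoreRows q (canonPolymerRows q)).treeLen K (b + 1) Y))) := by
  classical
  have hbm : b ≤ F.m + K := by have := F.hm; omega
  change Y ∈ canonLocRows q K (b + 1) (Hist.triv (F.P K) (b + 1)) (b + 1) at hY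
  simp only [canonLocRows, if_pos hb, ite_true, mem_image] at hY
  obtain ⟨X, hX, rfl⟩ := hY
  change ChartAnalyticityAsCited (birthChartRows q K b (domSet (F := F) 𝔠.lane.carrier.M₁ K b X)) 𝔠.ρ
    ((𝔠.C25 + 𝔠.C63) * Real.exp (-(𝔠.κ * canonTreeLenRows q K (b + 1) (domSet (F := F) 𝔠.lane.carrier.M₁ K b X))))
  rw [canonTreeLenRows_domSet q K b hbm X]
  exact chartAnalyticityAsCited_birthChartRows_domSet q K b hb X hX

/-- ★ **THE LEG-RESCALED BIRTH CHART AT A RETAINED DOMAIN, UNDER THE LOCALITY DISPLAY**: if `Ψ_X` and `Λ_X` read only the legs `c` with `dist K b (domSet X) c ≤ R` (print's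
«𝒫(X,·) depends on U restricted to X̃», p.263 L4 — a HYPOTHESIS, not a record row today), then for `κ′ ≥ 0` the leg-rescaled birth chart `rescaleΦw dist κ′ (birthChartRows q) K b (domSet X)`
is `ChartAnalyticityAsCited … (𝔠.ρ·e^{−κ′R}) ((C25 + C63)·e^{−κ·dj X})` (✓`chartAnalyticityAsCited_rescale_of_local` on `chartAnalyticityAsCited_birthChartRows_domSet`).
[cite: Balaban1985UV3, p.263 L4, (25) p.262, (29)-(30) p.263, (45) p.267] -/
theorem chartAnalyticityAsCited_rescaleW_birthChartRows_domSet_of_local (dist : LegDist F) {κ' R : ℝ} (hκ' : 0 ≤ κ') (K b : ℕ) (hb : b + 1 ≤ K)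
    (X : (tsys 3 (nblkOf (SK F 𝔠 γ hγ hγ1 K) 𝔠.lane.carrier b)).Dom) (hX : X ∈ newDomsRows q K b (Hist.triv (F.P K) (b + 1)))
    (hlocΨ : ∀ z : PBond (F.P K) b → ↥(lieC (suGroupModel 2)),
      ((q K).𝔖 b).Ψ X z = ((q K).𝔖 b).Ψ X (fun c => if dist K b (domSet (F := F) 𝔠.lane.carrier.M₁ K b X) c ≤ R then z c else 0))
    (hlocΛ : ∀ z : PBond (F.P K) b → ↥(lieC (suGroupModel 2)),
      ((q K).𝔄.Λc b).Ψ X z = ((q K).𝔄.Λc b).Ψ X (fun c => if dist K b (domSet (F := F) 𝔠.lane.carrier.M₁ K b X) c ≤ R then z c else 0)) :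
    ChartAnalyticityAsCited (rescaleΦw dist κ' (birthChartRows q) K b (domSet (F := F) 𝔠.lane.carrier.M₁ K b X)) (𝔠.ρ * Real.exp (-(κ' * R)))
      ((𝔠.C25 + 𝔠.C63) * Real.exp (-(𝔠.κ * (tsys 3 (nblkOf (SK F 𝔠 γ hγ hγ1 K) 𝔠.lane.carrier b)).dj X))) := by
  have hloc : ∀ z : PBond (F.P K) b → ↥(lieC (suGroupModel 2)),
      birthChartRows q K b (domSet (F := F) 𝔠.lane.carrier.M₁ K b X) z =
        birthChartRows q K b (domSet (F := F) 𝔠.lane.carrier.M₁ K b X) (fun c => if dist K b (domSet (F := F) 𝔠.lane.carrier.M₁ K b X) c ≤ R then z c else 0) := by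
    intro z
    rw [birthChartRows_domSet q K b hb X hX]
    exact congrArg₂ (· + ·) (hlocΨ z) (hlocΛ z)
  exact chartAnalyticityAsCited_rescale_of_local dist hκ' (chartAnalyticityAsCited_birthChartRows_domSet q K b hb X hX) hloc

end Birth

/-! ## §3 The own-indexed analyticity row of the leg-rescaled natural chart family, reduced to: locality, the (43) kernel budget, the dummy top clause -/

section Row

open scoped Nat
variable {F : T3Family} {𝔠 : AlphaConsts F.L (suGroupModel 2).N} {γ : ℝ} {hγ : 0 < γ} {hγ1 : γ ≤ (min 𝔠.gamma0 1) ^ 2}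
  (q : ∀ K, AlphaInputsT3AC.PkgCoreRows F 𝔠 γ hγ hγ1 K)
  (N : (K b : ℕ) → Site (F.P K) (1 + b) → (n : ℕ) → (Fin n → PBond (F.P K) b) → ContinuousMultilinearMap ℂ (fun _ : Fin n => ↥(lieC (suGroupModel 2))) ℂ)

open Classical in
/-- ★★ **(R2′)-OWN FOR THE LEG-RESCALED NATURAL CHART FAMILY `Φ♮[birthChartRows q, N]` AT THE ROWS DATUM, FROM THREE PRINT-SHAPED LETTERS**: with decay `κ ≤ 𝔠.κ`, amplitude
`C25 + C63 ≤ C_A`, radius `𝔠.ρ·e^{−κ′R}` (`κ′ ≥ 0`): (ℓ) LOCALITY — every retained step-`b` chart `Ψ_X`, `Λ_X` (`b + 1 ≤ K`) reads only the legs `c` with `dist K b (domSet X) c ≤ R`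
(print p.263 L4; a hypothesis — the record has no such row today); (k) THE (43) KERNEL BUDGET at every listed block, at the shrunk radius; (t) THE DUMMY TOP CLAUSE — the background row
at the listed non-block point sets above the top (`K < k`; only `univ` at term level `1`, read by no socket row).  Then
`ChartAnalyticOwnΦ (dataOfCoreRows q (canonPolymerRows q)) (rescaleΦw dist κ′ Φ♮) κ (𝔠.ρ·e^{−κ′R}) C_A` (✓`chartAnalyticOwnΦ_rescaleW_naturalChart_rows` with its background half
below the top supplied by `chartAnalyticityAsCited_rescaleW_birthChartRows_domSet_of_local`, i.e. BY THE RECORD's G3D-01/G3D-07 rows). [cite: Balaban1985UV3, p.263 L4, (25) p.262, (29)-(30) p.263, (43) p.266, (45) p.267] -/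
theorem chartAnalyticOwnΦ_rescaleW_naturalChart_rows_of_local (dist : LegDist F) {κ' R κ C_A : ℝ} (hκ' : 0 ≤ κ') (hκ : κ ≤ 𝔠.κ)
    (hCA : 𝔠.C25 + 𝔠.C63 ≤ C_A)
    (hloc : ∀ (K b : ℕ), b + 1 ≤ K → ∀ X ∈ newDomsRows q K b (Hist.triv (F.P K) (b + 1)), ∀ z : PBond (F.P K) b → ↥(lieC (suGroupModel 2)),
      ((q K).𝔖 b).Ψ X z = ((q K).𝔖 b).Ψ X (fun c => if dist K b (domSet (F := F) 𝔠.lane.carrier.M₁ K b X) c ≤ R then z c else 0) ∧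
      ((q K).𝔄.Λc b).Ψ X z = ((q K).𝔄.Λc b).Ψ X (fun c => if dist K b (domSet (F := F) 𝔠.lane.carrier.M₁ K b X) c ≤ R then z c else 0))
    (hker : ∀ (K k b : ℕ) (y : Site (F.P K) (1 + b)), blockSet K (1 + b) y ∈ canonLocRows q K k (Hist.triv (F.P K) k) (1 + b) →
      ∑ n ∈ Finset.Ico 2 7, ((n ! : ℝ))⁻¹ * ∑ c : Fin n → PBond (F.P K) b,
        ‖N K b y n c‖ * (∏ i, Real.exp (κ' * dist K b (blockSet K (1 + b) y) (c i))) * (𝔠.ρ * Real.exp (-(κ' * R)) / 2) ^ n ≤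
          C_A * Real.exp (-κ * (AlphaInputsT3AC.dataOfCoreRows q (canonPolymerRows q)).treeLen K (1 + b) (blockSet K (1 + b) y)))
    (hTop : ∀ (K k b : ℕ) (Y : Set (Site (F.P K) 0)), K < k → Y ∈ canonLocRows q K k (Hist.triv (F.P K) k) (1 + b) → (∀ y : Site (F.P K) (1 + b), blockSet K (1 + b) y ≠ Y) →
      ChartAnalyticityAsCited (rescaleΦw dist κ' (birthChartRows q) K b Y) (𝔠.ρ * Real.exp (-(κ' * R)))
        (C_A * Real.exp (-κ * (AlphaInputsT3AC.dataOfCoreRows q (canonPolymerRows q)).treeLen K (1 + b) Y))) :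
    ChartAnalyticOwnΦ (AlphaInputsT3AC.dataOfCoreRows q (canonPolymerRows q)) (rescaleΦw dist κ' (fun K b Y =>
        if h : ∃ y : Site (F.P K) (1 + b), blockSet K (1 + b) y = Y then
          (fun x : PBond (F.P K) b → ↥(lieC (suGroupModel 2)) =>
            ∑ n ∈ Finset.Ico 2 7, ((n ! : ℂ))⁻¹ * ∑ c : Fin n → PBond (F.P K) b, N K b h.choose n c (fun i => x (c i)))
        else birthChartRows q K b Y)) κ (𝔠.ρ * Real.exp (-(κ' * R))) C_A := by
  classical
  have hρ' : 0 < 𝔠.ρ * Real.exp (-(κ' * R)) := mul_pos 𝔠.ρ_pos (Real.exp_pos _)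
  refine chartAnalyticOwnΦ_rescaleW_naturalChart_rows q N dist hρ' (fun K k b Y hY hnb => ?_) hker
  by_cases hk : K < k
  · exact hTop K k b Y hk hY hnb
  · -- below the top a listed non-block point set is a retained domain's point set at the new level `k = b + 1`
    rw [not_lt] at hk
    have hm := F.hm
    obtain ⟨X, hX, rfl, hbk⟩ : ∃ X ∈ newDomsRows q K b (Hist.triv (F.P K) (b + 1)), domSet (F := F) 𝔠.lane.carrier.M₁ K b X = Y ∧ k = b + 1 := by
      cases k with
      | zero => simp [canonLocRows] at hY
      | succ j =>
        have hj : j + 1 ≤ K := hk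
        by_cases hi : 1 + b = j + 1
        · have hbj : b = j := by omega
          subst hbj
          simp only [canonLocRows, if_pos hj, if_pos hi, mem_image] at hY
          obtain ⟨X, hX, hXY⟩ := hY
          exact ⟨X, hX, hXY, by omega⟩
        · by_cases hi' : 1 + b ∈ Finset.Icc 1 j
          · simp only [canonLocRows, if_pos hj, if_neg hi, if_pos hi', mem_image] at hY
            obtain ⟨y, -, hy⟩ := hY
            exact absurd hy (hnb y)
          · simp only [canonLocRows, if_pos hj, if_neg hi, if_neg hi'] at hY
            simp at hY
    have hb : b + 1 ≤ K := by omega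
    have hbm : b ≤ F.m + K := by omega
    have h := chartAnalyticityAsCited_rescaleW_birthChartRows_domSet_of_local q dist hκ' K b hb X hX (fun z => (hloc K b hb X hX z).1) (fun z => (hloc K b hb X hX z).2)
    refine chartAnalyticityAsCited_mono h ?_
    -- `(C25 + C63)·e^{−𝔠.κ·dj X} ≤ C_A·e^{−κ·𝓛_K(1+b, domSet X)}` with `𝓛 = dj X ≥ 0`, `κ ≤ 𝔠.κ`
    have htl : (AlphaInputsT3AC.dataOfCoreRows q (canonPolymerRows q)).treeLen K (1 + b) (domSet (F := F) 𝔠.lane.carrier.M₁ K b X) =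
        (tsys 3 (nblkOf (SK F 𝔠 γ hγ hγ1 K) 𝔠.lane.carrier b)).dj X := by
      rw [show 1 + b = b + 1 by omega]
      exact canonTreeLenRows_domSet q K b hbm X
    rw [htl]
    have hdj : 0 ≤ (tsys 3 (nblkOf (SK F 𝔠 γ hγ hγ1 K) 𝔠.lane.carrier b)).dj X := by
      have h0 := canonTreeLenRows_nonneg q K (b + 1) (domSet (F := F) 𝔠.lane.carrier.M₁ K b X)
      rwa [canonTreeLenRows_domSet q K b hbm X] at h0
    have hC0 : 0 ≤ 𝔠.C25 + 𝔠.C63 := add_nonneg 𝔠.C25_nonneg 𝔠.C63_nonneg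
    have hexp : Real.exp (-(𝔠.κ * (tsys 3 (nblkOf (SK F 𝔠 γ hγ hγ1 K) 𝔠.lane.carrier b)).dj X)) ≤
        Real.exp (-κ * (tsys 3 (nblkOf (SK F 𝔠 γ hγ hγ1 K) 𝔠.lane.carrier b)).dj X) := Real.exp_le_exp.mpr (by nlinarith)
    calc (𝔠.C25 + 𝔠.C63) * Real.exp (-(𝔠.κ * (tsys 3 (nblkOf (SK F 𝔠 γ hγ hγ1 K) 𝔠.lane.carrier b)).dj X))
        ≤ (𝔠.C25 + 𝔠.C63) * Real.exp (-κ * (tsys 3 (nblkOf (SK F 𝔠 γ hγ hγ1 K) 𝔠.lane.carrier b)).dj X) := mul_le_mul_of_nonneg_left hexp hC0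
      _ ≤ C_A * Real.exp (-κ * (tsys 3 (nblkOf (SK F 𝔠 γ hγ hγ1 K) 𝔠.lane.carrier b)).dj X) := mul_le_mul_of_nonneg_right hCA (Real.exp_pos _).le

end Row

end Summit.QuantumFields.YangMills.Theorems.GlobalSlackKernelLeg

end
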